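import Mathlib
import Summits.Ventures.HodgeRepro.Tier4.Common.TargetData
import Summits.Ventures.HodgeRepro.Tier4.Line4.TraceZeroQuad
import Summits.Ventures.HodgeRepro.Tier4.Line4.CMPlaceBridge
import Summits.Ventures.HodgeRepro.Tier4.Line4.SeesawScalars

/-!
# Tier4/Line4/SeesawPlaneInstance — C-L4-PLANE-INSTANCE: the wall's (A1)+(A2) binders inhabited from the face data and a
pair of lines

Blind re-derivation cell `pub-hodge-repro`, Tier 4 «prove the step» (README §9–§10), seat t4-L1-p1 g5 (prover, LINE L4
chair; plan-4 g7's cut S16257 (3)).  Tree path `lean/Summits/Ventures/HodgeRepro/Tier4/Line4/SeesawPlaneInstance.lean`.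
Mathlib-level; no literature; no `def`.

WHAT IS PROVED (sorry-free, axioms `[propext, Classical.choice, Quot.sound]`; `c := complexConj E`).
* **`seesawPlane_data_of_pair (d : TargetData F E) (e₁ e₂) (h₁ : e₁ ≠ 0) (h₂ : e₂ ≠ 0) (horth : ⟪e₁,e₂⟫ = 0)
  (hpos₁ : 0 < Re τ₀⟪e₁,e₁⟫) (hneg₂ : Re τ₀⟪e₂,e₂⟫ < 0)`**: there are a TRACE-ZERO quadratic datum `q` describing
  `E/E⁺` (typer-2's `exists_traceZero_describesCM`, TraceZeroQuad p714383) and scalars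
  `a = ![⟪e₁,e₁⟫, ⟪e₁,e₁⟫, −⟪e₂,e₂⟫, −⟪e₂,e₂⟫]` (SeesawScalars' `lineScalar`, p716585) with `q.t = 0`, the unfolded
  `DescribesCM` clause, `∀ i, a i ≠ 0` (`d.hani`), `∀ i, 0 < Re τ₀(a i)` (the pair's signs) and
  `SeesawDefinite q a (mk (τ₀ ∘ ι))` (CARRY through `seesawDefinite_of_lines`) — the wall's binders
  `q _hq ht a _ha _hpos` and the (8) carrier `hdef`, by name.
* **`exists_seesawPlane_data (d) (hpair : ∃ e₁ e₂, …)`**: the `∃ q a` form with the LINE PAIR as a displayed hypothesis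
  — discharged by name the moment L1-p3's `SylvesterLines` (C-L4-LINE-PAIR, S16227) lands.

RECORD (plan-4 S16257): this is the IDENTITY INSTANCE of the second plane — `a 1 = a 0`, `a 3 = a 2`, so the similitude
data `g = g' = 1`, `lam = 1` satisfy `hgg' hg'g hgΩ _hiso` trivially; (A3), the similitude between two DIFFERENT planes
(which lines the mixed classes `ξ₁₃`, `ξ₂₄` live on), stays OPEN — this theorem inhabits the wall's (A1)+(A2) binders,
it does not choose the planes.  Nothing here says anything about the status of the Hodge conjecture for CM abelian
varieties, which is NOT proved (HC_CM is NOT proved by anyone in this repository).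
-/

set_option autoImplicit false
noncomputable section
namespace Summit.Ventures.HodgeRepro.Tier4.Line4
open Summit.Ventures.HodgeRepro.Tier4 Summit.Ventures.HodgeRepro.Tier4.Common NumberField Matrix

section Instance
variable {F E : Type} [Field F] [NumberField F] [IsGalois ℚ F] [IsCMField F]
  [Field E] [NumberField E] [IsGalois ℚ E] [IsCMField E]

/-- **C-L4-PLANE-INSTANCE from a given pair of lines**: the wall's `(q, a)` with `q.t = 0`, the unfolded `DescribesCM`
clause, `a i ≠ 0`, `0 < Re τ₀(a i)` and the (8) carrier `SeesawDefinite`, from the face's `H hH hani τ₀ hdef` and a pair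
of non-zero `H`-orthogonal lines `e₁` (positive at `τ₀`), `e₂` (negative at `τ₀`); `a = ![⟪e₁,e₁⟫, ⟪e₁,e₁⟫, −⟪e₂,e₂⟫,
−⟪e₂,e₂⟫]` (the identity instance of the second plane). -/
theorem seesawPlane_data_of_pair (d : TargetData F E) (e₁ e₂ : Fin 3 → E) (h₁ : e₁ ≠ 0) (h₂ : e₂ ≠ 0)
    (horth : hform (IsCMField.complexConj E).toRingEquiv d.H e₁ e₂ = 0)
    (hpos₁ : 0 < (d.τ₀ (hform (IsCMField.complexConj E).toRingEquiv d.H e₁ e₁)).re)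
    (hneg₂ : (d.τ₀ (hform (IsCMField.complexConj E).toRingEquiv d.H e₂ e₂)).re < 0) :
    ∃ (q : QuadData ↥(maximalRealSubfield E)) (a : Fin 4 → ↥(maximalRealSubfield E)),
      q.t = 0 ∧
      (∃ ω : E, ω ^ 2 = algebraMap ↥(maximalRealSubfield E) E q.t * ω - algebraMap ↥(maximalRealSubfield E) E q.n ∧
        IsCMField.complexConj E ω = algebraMap ↥(maximalRealSubfield E) E q.t - ω ∧
        IsCMField.complexConj E ω ≠ ω) ∧
      (∀ i, a i ≠ 0) ∧
      (∀ i, 0 < (d.τ₀ (algebraMap ↥(maximalRealSubfield E) E (a i))).re) ∧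
      SeesawDefinite q a (InfinitePlace.mk (d.τ₀.comp (algebraMap ↥(maximalRealSubfield E) E))) := by
  obtain ⟨n, hq⟩ := exists_traceZero_describesCM E
  set a : Fin 4 → ↥(maximalRealSubfield E) :=
    ![lineScalar d.hH e₁, lineScalar d.hH e₁, -lineScalar d.hH e₂, -lineScalar d.hH e₂] with ha
  have hne₁ : lineScalar d.hH e₁ ≠ 0 := by
    intro h0
    have := congrArg (algebraMap ↥(maximalRealSubfield E) E) h0
    rw [algebraMap_lineScalar, map_zero] at this
    exact hform_self_ne_zero_of_anisotropic _ d.H d.hani h₁ this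
  have hne₂ : lineScalar d.hH e₂ ≠ 0 := by
    intro h0
    have := congrArg (algebraMap ↥(maximalRealSubfield E) E) h0
    rw [algebraMap_lineScalar, map_zero] at this
    exact hform_self_ne_zero_of_anisotropic _ d.H d.hani h₂ this
  have hneg₂' : 0 < (d.τ₀ (algebraMap ↥(maximalRealSubfield E) E (-lineScalar d.hH e₂))).re := by
    rw [algebraMap_neg_lineScalar, map_neg, Complex.neg_re]
    linarith
  refine ⟨⟨0, n⟩, a, rfl, hq, ?_, ?_, ?_⟩
  · intro i
    fin_cases i
    · exact hne₁
    · exact hne₁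
    · exact neg_ne_zero.2 hne₂
    · exact neg_ne_zero.2 hne₂
  · intro i
    fin_cases i
    · exact hpos₁
    · exact hpos₁
    · exact hneg₂'
    · exact hneg₂'
  · exact seesawDefinite_of_lines d.H d.hH d.τ₀ d.hdef d.hani ⟨0, n⟩ (isCMAt_of_describesCM ⟨0, n⟩ hq) e₁ e₂ h₁ h₂
      horth a rfl rfl

/-- **C-L4-PLANE-INSTANCE, the `∃` form**: the same with the LINE PAIR as a displayed hypothesis (C-L4-LINE-PAIR,
L1-p3's `SylvesterLines`, by name when it lands). -/
theorem exists_seesawPlane_data (d : TargetData F E)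
    (hpair : ∃ e₁ e₂ : Fin 3 → E, e₁ ≠ 0 ∧ e₂ ≠ 0 ∧ hform (IsCMField.complexConj E).toRingEquiv d.H e₁ e₂ = 0 ∧
      0 < (d.τ₀ (hform (IsCMField.complexConj E).toRingEquiv d.H e₁ e₁)).re ∧
      (d.τ₀ (hform (IsCMField.complexConj E).toRingEquiv d.H e₂ e₂)).re < 0) :
    ∃ (q : QuadData ↥(maximalRealSubfield E)) (a : Fin 4 → ↥(maximalRealSubfield E)),
      q.t = 0 ∧
      (∃ ω : E, ω ^ 2 = algebraMap ↥(maximalRealSubfield E) E q.t * ω - algebraMap ↥(maximalRealSubfield E) E q.n ∧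
        IsCMField.complexConj E ω = algebraMap ↥(maximalRealSubfield E) E q.t - ω ∧
        IsCMField.complexConj E ω ≠ ω) ∧
      (∀ i, a i ≠ 0) ∧
      (∀ i, 0 < (d.τ₀ (algebraMap ↥(maximalRealSubfield E) E (a i))).re) ∧
      SeesawDefinite q a (InfinitePlace.mk (d.τ₀.comp (algebraMap ↥(maximalRealSubfield E) E))) := by
  obtain ⟨e₁, e₂, h₁, h₂, horth, hpos₁, hneg₂⟩ := hpair
  exact seesawPlane_data_of_pair d e₁ e₂ h₁ h₂ horth hpos₁ hneg₂

end Instance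

end Summit.Ventures.HodgeRepro.Tier4.Line4

end
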